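import Summits.AnomalousDissipation.AnomalousDissipation.Theorems.SolenoidalFractalHomogenisationLagrangianCarrierConstructionTowerStepA
import HarnessLib

/-!
# K3L `LagrangianCarrierConstruction` (stmt-AnomalousDissipation-24913), line `birth`, stub `stub_flowsL`:
# time periodicity along the Lagrangian tower (helper; `--supports stmt-AnomalousDissipation-24913`)

Summits-side helper file (everything proved; no definitions, no named facts). Towards clause (L4) of `LevelRegular` (every level field
`b (m+1)` is time periodic): if the coarse relative flow `X(t, s) = A t ∘ (A s)⁻¹` is `T`-periodic (`X(t+T, s+T) = X(t, s)`), the Eulerian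
field `v` is `T`-periodic and `T` is a whole number `q` of refresh windows, then so is the next relative flow built by the window formula,
and the inserted velocity is `T`-periodic. Ingredients: the evolution maps of a periodic field commute with the time shift
(`evolutionMap_add_period`, uniqueness); the transition maps are `q`-periodic in the window index, whence `C (j + q) = (C q).trans (C j)`
(two-sided induction); the shift of the window index `⌊(t+T)/R⌋ = ⌊t/R⌋ + q`. NOT a proof of anomalous dissipation.
-/

set_option linter.dupNamespace false

noncomputable section

namespace Summit.AnomalousDissipation.AnomalousDissipation.Theorems.SolenoidalFractalHomogenisation.LagrangianCarrierConstruction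

open Set Function Filter Topology Metric
open scoped NNReal
open Literature.Analysis.ODE Literature.Analysis.FunctionSpaces

section Evolution

variable {V : Type*} [NormedAddCommGroup V] [NormedSpace ℝ V] [CompleteSpace V]

/-- **Evolution maps of a time-periodic field commute with the time shift**: `φ(t+T, s+T, z) = φ(t, s, z)` (uniqueness). [folklore] -/
theorem evolutionMap_add_period {v : ℝ → V → V} (hv : IsUniformlyLipschitzOn v univ) {T : ℝ} (hper : ∀ t z, v (t + T) z = v t z)
    (s t : ℝ) (z : V) : evolutionMap v (s + T) (t + T) z = evolutionMap v s t z := by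
  have hγ : ∀ τ ∈ (univ : Set ℝ), HasDerivWithinAt (fun τ => evolutionMap v s (τ - T) z)
      (v τ (evolutionMap v s (τ - T) z)) univ τ := by
    intro τ _
    have h := (hasDerivAt_evolutionMap_univ hv s (τ - T) z).comp_sub_const τ T
    have e : v (τ - T) = v τ := funext fun y => by have := hper (τ - T) y; rw [sub_add_cancel] at this; exact this.symm
    rw [e] at h
    exact h.hasDerivWithinAt
  have h := hv.evolutionMap_eq convex_univ (mem_univ (s + T)) hγ (mem_univ (t + T))
  simp only [add_sub_cancel_right, evolutionMap_self] at h
  exact h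

end Evolution

section Windows

variable {R T : ℝ} {q : ℕ}

/-- The window index shifts by `q` under `t ↦ t + qR`. [folklore] -/
theorem floor_add_period (hR : 0 < R) (hT : T = (q : ℝ) * R) (t : ℝ) : ⌊(t + T) / R⌋ = ⌊t / R⌋ + q := by
  rw [hT, add_div, mul_div_cancel_right₀ _ hR.ne', show ((q : ℕ) : ℝ) = ((q : ℤ) : ℝ) by simp, Int.floor_add_intCast]

/-- The window left end shifts by `T`. [folklore] -/
theorem floor_mul_add_period (hR : 0 < R) (hT : T = (q : ℝ) * R) (t : ℝ) :
    ((⌊(t + T) / R⌋ : ℝ)) * R = (⌊t / R⌋ : ℝ) * R + T := by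
  rw [floor_add_period hR hT, hT]; push_cast; ring

end Windows

section Chain

variable {V : Type*} (C M : ℤ → V ≃ V)

/-- **Periodic transition maps give shifted accumulated maps**: if `M (j + q) = M j` then `C (j + q) = (C q).trans (C j)`. [folklore] -/
theorem chain_add_period (hC0 : C 0 = Equiv.refl V) (hC : ∀ j : ℤ, C (j + 1) = (C j).trans (M j)) (q : ℤ)
    (hM : ∀ j : ℤ, M (j + q) = M j) : ∀ j : ℤ, C (j + q) = (C q).trans (C j) := by
  intro j
  induction j using Int.induction_on with
  | zero => rw [zero_add, hC0, Equiv.trans_refl]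
  | succ i ih =>
    rw [show (i : ℤ) + 1 + q = (i + q) + 1 by ring, hC, ih, hM, hC, Equiv.trans_assoc]
  | pred i ih =>
    have e1 := chain_pred C M hC (-(i : ℤ))
    have e2 := chain_pred C M hC (-(i : ℤ) + q)
    rw [show (-(i : ℤ) - 1 + q) = (-(i : ℤ) + q) - 1 by ring, e2, ih, e1, show (-(i : ℤ) + q - 1) = (-(i : ℤ) - 1) + q by ring, hM,
      Equiv.trans_assoc]

end Chain

section Step

variable {d : Type*} [Fintype d]

/-- **Time periodicity propagates along the tower.** With the window formula `A' t = A t ∘ A(w)⁻¹ ∘ Z(t, w) ∘ C ⌊t/R⌋` (`w = ⌊t/R⌋R`): if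
`X(t+T, s+T) = X(t, s)` for the coarse relative flow `X(t,s) = A t ∘ (A s)⁻¹`, the field is `T`-periodic, and `T = qR`, then the next relative
flow is `T`-periodic and so is the inserted velocity. [folklore] -/
theorem tower_step_periodic (A : ℝ → EuclideanSpace ℝ d ≃ EuclideanSpace ℝ d)
    (v : ℝ → EuclideanSpace ℝ d → EuclideanSpace ℝ d) (hv : IsUniformlyLipschitzOn v univ)
    {R T : ℝ} (hR : 0 < R) {q : ℕ} (hT : T = (q : ℝ) * R)
    (hX : ∀ t s z, A (t + T) ((A (s + T)).symm z) = A t ((A s).symm z)) (hvT : ∀ t z, v (t + T) z = v t z)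
    (Z : ℝ → ℝ → EuclideanSpace ℝ d ≃ EuclideanSpace ℝ d) (hZ : ∀ t s z, Z t s z = evolutionMap v s t z)
    (hZ' : ∀ t s z, (Z t s).symm z = evolutionMap v t s z)
    (C : ℤ → EuclideanSpace ℝ d ≃ EuclideanSpace ℝ d) (hC0 : C 0 = Equiv.refl _)
    (hC : ∀ j : ℤ, C (j + 1) = (C j).trans ((Z (((j : ℝ) + 1) * R) ((j : ℝ) * R)).trans
      ((A ((j : ℝ) * R)).symm.trans (A (((j : ℝ) + 1) * R)))))
    (A' : ℝ → EuclideanSpace ℝ d ≃ EuclideanSpace ℝ d)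
    (hA'def : ∀ t, A' t = (C ⌊t / R⌋).trans ((Z t ((⌊t / R⌋ : ℝ) * R)).trans ((A ((⌊t / R⌋ : ℝ) * R)).symm.trans (A t)))) :
    (∀ t s z, A' (t + T) ((A' (s + T)).symm z) = A' t ((A' s).symm z)) ∧
    (∀ t z, fderiv ℝ (fun y => A (t + T) ((A ((⌊(t + T) / R⌋ : ℝ) * R)).symm y))
        (A ((⌊(t + T) / R⌋ : ℝ) * R) ((A (t + T)).symm z)) (v (t + T) (A ((⌊(t + T) / R⌋ : ℝ) * R) ((A (t + T)).symm z))) =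
      fderiv ℝ (fun y => A t ((A ((⌊t / R⌋ : ℝ) * R)).symm y)) (A ((⌊t / R⌋ : ℝ) * R) ((A t).symm z))
        (v t (A ((⌊t / R⌋ : ℝ) * R) ((A t).symm z)))) := by
  -- periodicity of the Eulerian evolution and of the coarse relative flow, as functions
  have hZT : ∀ t s z, Z (t + T) (s + T) z = Z t s z := fun t s z => by rw [hZ, hZ, evolutionMap_add_period hv hvT]
  have hZT' : ∀ t s z, (Z (t + T) (s + T)).symm z = (Z t s).symm z := fun t s z => by
    rw [hZ', hZ', evolutionMap_add_period hv hvT]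
  have hXfun : ∀ t s, (fun y => A (t + T) ((A (s + T)).symm y)) = fun y => A t ((A s).symm y) :=
    fun t s => funext fun y => hX t s y
  have hX' : ∀ t s z, A (s + T) ((A (t + T)).symm z) = A s ((A t).symm z) := fun t s z => hX s t z
  -- the transition maps are `q`-periodic in the window index
  have hM : ∀ j : ℤ, (Z ((((j + q : ℤ) : ℝ) + 1) * R) (((j + q : ℤ) : ℝ) * R)).trans
      ((A (((j + q : ℤ) : ℝ) * R)).symm.trans (A ((((j + q : ℤ) : ℝ) + 1) * R))) =
      (Z (((j : ℝ) + 1) * R) ((j : ℝ) * R)).trans ((A ((j : ℝ) * R)).symm.trans (A (((j : ℝ) + 1) * R))) := by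
    intro j
    have e1 : (((j + q : ℤ) : ℝ) + 1) * R = ((j : ℝ) + 1) * R + T := by rw [hT]; push_cast; ring
    have e2 : ((j + q : ℤ) : ℝ) * R = (j : ℝ) * R + T := by rw [hT]; push_cast; ring
    rw [e1, e2]
    ext z
    simp only [Equiv.trans_apply]
    rw [hZT, hX]
  have hCq := chain_add_period C _ hC0 hC q hM
  -- the window formula at shifted times: `A' (t + T) = (C q).trans (A' t)`
  have hEq : ∀ t, A' (t + T) = (C q).trans (A' t) := by
    intro t
    ext z
    rw [hA'def, hA'def, floor_mul_add_period hR hT, floor_add_period hR hT, hCq]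
    simp only [Equiv.trans_apply]
    rw [hZT, hX]
  constructor
  · intro t s z
    rw [hEq t, hEq s]
    simp
  · intro t z
    rw [floor_mul_add_period hR hT, hXfun, hX', hvT]

end Step

end Summit.AnomalousDissipation.AnomalousDissipation.Theorems.SolenoidalFractalHomogenisation.LagrangianCarrierConstruction

end
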